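import Literature.AlgebraicGeometry.HodgeTheory.HyperplaneClassLine
import HarnessLib

/-!
# BiquadraticSecantLift · X2 — two closed immersions `X ⟶ ℙᴺ`, one hyperplane scalar
# (part 1 of «the product polarization `π₀^* k + m·π₁^* k` on `⨁_{Fin 2} A` is a Kähler multiple»)

Helper file for crux X2 `BiquadraticBaseChangeHyperbolic` (stmt-HodgeConjecture-22133) of
route-HodgeConjecture-BiquadraticSecantLift: the POLARIZATION of the twelvefold `B = ⨁_{Fin 2} A` («`E_A ⊕ m·E_A`» of
the route text), on the tree's carriers (`HodgeTheory.IsKaehlerClass`, model-free). For a complex abelian variety `A`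
with `φ : A ⟶ A`, `d ≥ 1`, `m ≥ 2`, a projective embedding `e` of `B` and a rational class `a ≠ 0` on `ℙᴺ`:

* §1 `exists_map_eq_smul_of_pullback_eq_fubiniStudy_pair` — the tree's `HyperplaneClassLine` lemma for TWO closed
  immersions `ι, ι' : X ⟶ ℙᴺ` at once: `ι^* a = s • H_ι` and `ι'^* a = s • H_{ι'}` with the SAME scalar `s`
  (`H_ι` the class with `M^* H_ι = e[θ_ι] ⊗ 1` in one Hodge model `M` of `X`; the scalar is the rigidity constant of
  `M`, independent of the immersion), and its real form;
* §2 `exists_isKaehlerClass_smul_restrictions` — hence `κ = ι₀^*(e^*a) + ι₁^*(e^*a) ∈ H²(A)`, the sum of the two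
  hyperplane classes of `A` along the closed immersions `ιⱼ ≫ e : A ⟶ B ⟶ ℙᴺ`, is a non-zero real multiple of a
  Kähler class, and so is `k = d·κ + φ^*κ` (`IsKaehlerClass.smul_add_map`);
* §3 `exists_isKaehlerClass_smul_prodClass` — **`h₂ = π₀^* k + m·π₁^* k` is a non-zero real multiple of a Kähler class
  of `B`**: `h_s = e^*a + σ^*e^*a` (`σ` the swap) is a Kähler multiple (`smul_add_map`), its block-diagonal part
  `Σⱼ (πⱼ ≫ ιⱼ)^* h_s = π₀^*κ + π₁^*κ` is one (`Deligne1982.isKaehlerClass_sum_map_blockProjection`),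
  `c·(π₀^*κ + π₁^*κ) + shift^*(π₀^*κ + π₁^*κ) = c·π₀^*κ + (c+1)·π₁^*κ` with `c = 1/(m-1)` is one (`smul_add_map` along
  `shift : (x, y) ↦ (y, 0)`), i.e. `π₀^*κ + m·π₁^*κ` is, and finally `d·(…) + (φ⊕φ)^*(…) = π₀^*k + m·π₁^*k`.

No product-of-Kähler-manifolds statement and no restriction-of-Kähler-forms statement is used. Nothing here is a case of
the Hodge conjecture (HC is NOT proved; X2 is not proved by this file).

## References
[cite: VoisinHodgeI2002, §3.1.3, §7.1.2, Thm. 7.10] [cite: Deligne1982HodgeCycles, §5 (c) p. 39 («θ = Σ fᵢθᵢ is a polarization»)]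
[cite: LangeBirkenhake1992, §5.2–5.3]
-/

-- every declaration of this problem lives in `Summit.HodgeConjecture.HodgeConjecture.…` (summit = sub-problem)
set_option linter.dupNamespace false

noncomputable section

open scoped Manifold ContDiff
open CategoryTheory CategoryTheory.Limits AlgebraicGeometry
open Literature.AlgebraicTopology.SingularHomology Literature.Geometry.Kaehler
open Literature.NumberTheory.Transcendental
open Literature.AlgebraicGeometry.HodgeTheory
open Literature.AlgebraicGeometry.Motives (AbelianVariety projectiveSpace ComplexPoints IsSmoothProjective ProjectiveEmbedding)
open Literature.AlgebraicGeometry.Motives.AnalytificationKaehler (fubiniStudyPullbackForm)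

namespace Summit.HodgeConjecture.HodgeConjecture.BiquadraticSecantLift

/-! ## §1 Two immersions, one scalar -/

section Pair

variable {n : ℕ} {X : Literature.AlgebraicGeometry.Motives.SchemeOver ℂ}

/-- `X^an` is compact for `X` smooth projective (local copy of `HodgeModel.compactSpace_carrier`). -/
private theorem compactSpace_carrier₂ (A : HodgeModel n X) (hX : IsSmoothProjective n X) :
    CompactSpace A.carrier := by
  haveI : IsProper X.hom := Literature.AlgebraicGeometry.Motives.IsSmoothProjective.isProper_holds hX
  haveI : CompactSpace (ComplexPoints X) := Literature.AlgebraicGeometry.Motives.compactSpace_algPoints_of_isProper_holds X ℂ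
  exact A.isAnalytification.homeomorph.symm.compactSpace

/-- **Two closed immersions `ι, ι' : X ⟶ ℙᴺ`, one scalar.** For `X` smooth projective of dimension `n` with a Hodge model
`A`, a NATURAL real de Rham family `e`, and the hyperplane-type classes `H`, `H'` of `ι`, `ι'` (`A^* H = e[θ_ι] ⊗ 1`,
`A^* H' = e[θ_{ι'}] ⊗ 1`): every `a ∈ H²(ℙᴺ(ℂ); ℂ)` has `ι^* a = s • H` and `ι'^* a = s • H'` with the SAME `s ∈ ℂ`,
non-zero if `a ≠ 0` and `n ≥ 1`. Verbatim the argument of the tree's `exists_map_eq_smul_of_pullback_eq_fubiniStudy`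
(`HyperplaneClassLine`): `ι^* c_P = r⁻¹ • H` and `ι'^* c_P = r⁻¹ • H'` where `r` is the rigidity constant between the
comparison induced from a Hodge model of `ℙᴺ` and `e ⊗ ℂ` on `H²_dR(X^an; ℂ)` — it does not depend on the immersion.
[cite: VoisinHodgeI2002, Thm. 7.10, §7.1.2 and §7.3.2] [cite: HatcherAT2002, Thm. 3.19] -/
theorem exists_map_eq_smul_of_pullback_eq_fubiniStudy_pair (hX : IsSmoothProjective n X)
    (A : HodgeModel n X) {N : ℕ} (ι ι' : X ⟶ projectiveSpace N ℂ) [IsClosedImmersion ι.left] [IsClosedImmersion ι'.left]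
    (e : DeRhamIsoFamily 𝓘(ℝ, A.model)) (he : e.IsNatural)
    (hθ : fubiniStudyPullbackForm A.model ι A.toComplexPoints ∈ closedSmoothForms 𝓘(ℝ, A.model) A.carrier ℝ 2)
    (hθ' : fubiniStudyPullbackForm A.model ι' A.toComplexPoints ∈ closedSmoothForms 𝓘(ℝ, A.model) A.carrier ℝ 2)
    {H H' : complexBetti X 2}
    (hH : A.pullback 2 H = ofRealClass A.carrier 2 (e A.carrier 2
      (deRhamCohomology.mk ⟨fubiniStudyPullbackForm A.model ι A.toComplexPoints, hθ⟩)))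
    (hH' : A.pullback 2 H' = ofRealClass A.carrier 2 (e A.carrier 2
      (deRhamCohomology.mk ⟨fubiniStudyPullbackForm A.model ι' A.toComplexPoints, hθ'⟩)))
    (a : complexBetti (projectiveSpace N ℂ) 2) :
    ∃ s : ℂ, complexBetti.map ι 2 a = s • H ∧ complexBetti.map ι' 2 a = s • H' ∧ (1 ≤ n → a ≠ 0 → s ≠ 0) := by
  -- dimension `0`: `H²(X(ℂ); ℂ) = 0`
  rcases Nat.eq_zero_or_pos n with rfl | hn
  · haveI : Subsingleton (complexBetti X 2) :=
      Literature.AlgebraicGeometry.Motives.ComplexPoints.subsingleton_singularCohomology_of_lt hX ℂ (k := 2) (by omega)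
    exact ⟨0, Subsingleton.elim _ _, Subsingleton.elim _ _, fun h ↦ absurd h (by omega)⟩
  -- the projective space, a Hodge model `B` of it with comparison `e_P ⊗ ℂ`
  have hP : IsSmoothProjective N (projectiveSpace N ℂ) := isSmoothProjective_projectiveSpace' N
  have hnN : n ≤ N := le_of_isClosedImmersion_projectiveSpace hX ι
  obtain ⟨B₀⟩ := (nonempty_hodgeModel_holds (n := N) (X := projectiveSpace N ℂ)).nonempty hP
  obtain ⟨eP, heP, -, -⟩ := exists_deRhamIsoFamily_holds B₀.model
  let B : HodgeModel N (projectiveSpace N ℂ) :=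
    { B₀ with
      deRham := eP.complexify
      deRham_isNatural := DeRhamIsoFamily.complexify_isNatural heP }
  -- the Fubini–Study class `c_P` of `ℙᴺ`
  haveI : IsClosedImmersion (𝟙 (projectiveSpace N ℂ) : projectiveSpace N ℂ ⟶ projectiveSpace N ℂ).left :=
    show IsClosedImmersion (𝟙 (projectiveSpace N ℂ).left) from inferInstance
  have hθP := B.fubiniStudyPullbackForm_mem_closedSmoothForms (𝟙 (projectiveSpace N ℂ))
  obtain ⟨cP, hcP⟩ := B.pullback_surjective 2 (ofRealClass B.carrier 2 (eP B.carrier 2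
    (deRhamCohomology.mk ⟨fubiniStudyPullbackForm B.model (𝟙 (projectiveSpace N ℂ)) B.toComplexPoints, hθP⟩)))
  -- (1) `c_P = z₁ • r₀`, `a = z • r₀`
  obtain ⟨r₀, -, hgen⟩ := exists_isRationalClass_forall_eq_smul_projectiveSpace N
  obtain ⟨z₁, hz₁⟩ := hgen cP
  obtain ⟨z, hz⟩ := hgen a
  set wP : complexDeRhamCohomology B.model B.carrier 2 := complexDeRhamCohomology.ofReal B.model B.carrier 2
    (deRhamCohomology.mk ⟨fubiniStudyPullbackForm B.model (𝟙 (projectiveSpace N ℂ)) B.toComplexPoints, hθP⟩) with hwPdef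
  have hwc : B.pullback 2 cP = B.deRham B.carrier 2 wP := by
    rw [hcP, hwPdef]
    exact (complexifyFun_ofReal eP 2 _).symm
  -- (3) rigidity: `e ⊗ ℂ = r • e''` on `H²_dR(X^an; ℂ)` — independent of the immersion
  haveI : CompactSpace A.carrier := compactSpace_carrier₂ A hX
  obtain ⟨r, hr⟩ := NaturalDeRhamComparisonRigidity_holds A.model A.model (HodgeModel.inducedFamily B A hnN)
    (HodgeModel.isNatural_inducedFamily B A hnN) e.complexify (DeRhamIsoFamily.complexify_isNatural he)
    A.carrier A.carrier (Homeomorph.refl A.carrier) contMDiff_id contMDiff_id 2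
  have hr' : ∀ y : complexDeRhamCohomology A.model A.carrier 2,
      e.complexify A.carrier 2 y = r • HodgeModel.inducedIso B A hnN A.carrier 2 y := by
    intro y
    have h := hr y
    have h1 : (⟨Homeomorph.refl A.carrier, (Homeomorph.refl A.carrier).continuous⟩ : C(A.carrier, A.carrier)) =
        ContinuousMap.id A.carrier := rfl
    have h2 : complexDeRhamCohomology.map A.model
        (contMDiff_id : ContMDiff 𝓘(ℝ, A.model) 𝓘(ℝ, A.model) ∞ (Homeomorph.refl A.carrier)) 2 =
          LinearMap.id :=
      complexDeRhamCohomology.map_id (E := A.model) (M := A.carrier) 2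
    have lhs : singularCohomology.map ℂ ℂ
        (⟨Homeomorph.refl A.carrier, (Homeomorph.refl A.carrier).continuous⟩ : C(A.carrier, A.carrier)) 2
          (e.complexify A.carrier 2 y) = e.complexify A.carrier 2 y := by
      rw [h1, singularCohomology.map_id]
      rfl
    have rhs : HodgeModel.inducedFamily B A hnN A.carrier 2 (complexDeRhamCohomology.map A.model
        (contMDiff_id : ContMDiff 𝓘(ℝ, A.model) 𝓘(ℝ, A.model) ∞ (Homeomorph.refl A.carrier)) 2 y) =
          HodgeModel.inducedIso B A hnN A.carrier 2 y :=
      congrArg (HodgeModel.inducedIso B A hnN A.carrier 2) (LinearMap.congr_fun h2 y)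
    exact lhs.symm.trans (h.trans (congrArg (r • ·) rhs))
  -- (2) for EACH immersion `j` with class `Hj`: `Hj = r • j^* c_P`
  have key : ∀ (j : X ⟶ projectiveSpace N ℂ) [IsClosedImmersion j.left]
      (hθj : fubiniStudyPullbackForm A.model j A.toComplexPoints ∈ closedSmoothForms 𝓘(ℝ, A.model) A.carrier ℝ 2)
      {Hj : complexBetti X 2}
      (hHj : A.pullback 2 Hj = ofRealClass A.carrier 2 (e A.carrier 2
        (deRhamCohomology.mk ⟨fubiniStudyPullbackForm A.model j A.toComplexPoints, hθj⟩))),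
      Hj = r • singularCohomology.map ℂ ℂ (Literature.AlgebraicGeometry.Motives.AlgPoints.mapContinuous (L := ℂ) j) 2 cP := by
    intro j _ hθj Hj hHj
    have hfan : ContMDiff 𝓘(ℝ, A.model) 𝓘(ℝ, B.model) ∞ (HodgeModel.anMap B A j) :=
      HodgeModel.contMDiff_anMap B A j hX hP
    have keyj : A.pullback 2 (singularCohomology.map ℂ ℂ (Literature.AlgebraicGeometry.Motives.AlgPoints.mapContinuous (L := ℂ) j) 2 cP) =
        HodgeModel.inducedIso B A hnN A.carrier 2 (complexDeRhamCohomology.map A.model hfan 2 wP) := by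
      rw [HodgeModel.inducedIso_apply, ← LinearMap.comp_apply
          (g := complexDeRhamCohomology.map A.model hfan 2),
        ← complexDeRhamCohomology.map_comp hfan (contMDiff_cylFst B A hnN A.carrier),
        B.deRham_isNatural (Cyl B A hnN A.carrier) B.carrier _
          (hfan.comp (contMDiff_cylFst B A hnN A.carrier)) 2 wP,
        ← hwc, ← HodgeModel.map_anMap_pullback]
      change _ = ((singularCohomology.map ℂ ℂ _ 2 ≫ singularCohomology.map ℂ ℂ _ 2).hom _)
      rw [← singularCohomology.map_comp]
      rfl
    have hpull : (fubiniStudyPullbackForm B.model (𝟙 (projectiveSpace N ℂ)) B.toComplexPoints).pullback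
        𝓘(ℝ, A.model) (HodgeModel.anMap B A j) = fubiniStudyPullbackForm A.model j A.toComplexPoints := by
      have h := A.fubiniStudyPullbackForm_pullback_anMap B j (𝟙 (projectiveSpace N ℂ)) hX hP
      rwa [Category.comp_id] at h
    have hmap : complexDeRhamCohomology.map A.model hfan 2 wP =
        complexDeRhamCohomology.ofReal A.model A.carrier 2
          (deRhamCohomology.mk ⟨fubiniStudyPullbackForm A.model j A.toComplexPoints, hθj⟩) := by
      haveI : PullbackFacts 𝓘(ℝ, A.model) A.carrier 𝓘(ℝ, B.model) B.carrier ℝ := PullbackFacts.real_of_complex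
      rw [hwPdef, ← complexDeRhamCohomology.ofReal_map, deRhamCohomology.map_mk]
      congr 2
      exact Subtype.ext hpull
    have hHc : A.pullback 2 Hj = e.complexify A.carrier 2 (complexDeRhamCohomology.ofReal A.model A.carrier 2
        (deRhamCohomology.mk ⟨fubiniStudyPullbackForm A.model j A.toComplexPoints, hθj⟩)) := by
      rw [hHj]
      exact (complexifyFun_ofReal e 2 _).symm
    apply A.pullback_injective 2
    rw [map_smul, keyj, hmap, hHc, hr']
  have hH₁ := key ι hθ hH
  have hH₁' := key ι' hθ' hH'
  -- `H ≠ 0` (a Kähler class), so `r ≠ 0` and `z₁ ≠ 0`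
  have hK : A.IsKaehlerClassVia e H := A.isKaehlerClassVia_of_pullback_eq_fubiniStudyPullbackForm e hX ι hθ hH
  have hH0 : H ≠ 0 := hK.ne_zero hX hn
  have hr0 : r ≠ 0 := by
    rintro rfl
    exact hH0 (by rw [hH₁, zero_smul])
  have hz0 : z₁ ≠ 0 := by
    rintro rfl
    exact hH0 (by rw [hH₁, hz₁, zero_smul, map_zero, smul_zero])
  -- `j^* r₀ = (r z₁)⁻¹ • Hj` and `j^* a = z • j^* r₀`
  have hr₀ : ∀ (j : X ⟶ projectiveSpace N ℂ) {Hj : complexBetti X 2},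
      Hj = r • singularCohomology.map ℂ ℂ (Literature.AlgebraicGeometry.Motives.AlgPoints.mapContinuous (L := ℂ) j) 2 cP →
      singularCohomology.map ℂ ℂ (Literature.AlgebraicGeometry.Motives.AlgPoints.mapContinuous (L := ℂ) j) 2 a =
        (z * (r * z₁)⁻¹) • Hj := by
    intro j Hj hHj
    rw [hHj, hz₁, map_smul, hz, map_smul, smul_smul, smul_smul, mul_assoc, mul_assoc, inv_mul_cancel₀ (mul_ne_zero hr0 hz0),
      mul_one]
  refine ⟨z * (r * z₁)⁻¹, hr₀ ι hH₁, hr₀ ι' hH₁', fun _ ha0 ↦ ?_⟩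
  have hz' : z ≠ 0 := by
    rintro rfl
    exact ha0 (by rw [hz, zero_smul])
  exact mul_ne_zero hz' (inv_ne_zero (mul_ne_zero hr0 hz0))

/-- **Real form: for a rational `a ≠ 0` (and `n ≥ 1`) the common scalar is real and non-zero.** -/
theorem exists_real_map_eq_smul_of_pullback_eq_fubiniStudy_pair (hX : IsSmoothProjective n X) (hn : 1 ≤ n)
    (A : HodgeModel n X) {N : ℕ} (ι ι' : X ⟶ projectiveSpace N ℂ) [IsClosedImmersion ι.left] [IsClosedImmersion ι'.left]
    (e : DeRhamIsoFamily 𝓘(ℝ, A.model)) (he : e.IsNatural)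
    (hθ : fubiniStudyPullbackForm A.model ι A.toComplexPoints ∈ closedSmoothForms 𝓘(ℝ, A.model) A.carrier ℝ 2)
    (hθ' : fubiniStudyPullbackForm A.model ι' A.toComplexPoints ∈ closedSmoothForms 𝓘(ℝ, A.model) A.carrier ℝ 2)
    {H H' : complexBetti X 2}
    (hH : A.pullback 2 H = ofRealClass A.carrier 2 (e A.carrier 2
      (deRhamCohomology.mk ⟨fubiniStudyPullbackForm A.model ι A.toComplexPoints, hθ⟩)))
    (hH' : A.pullback 2 H' = ofRealClass A.carrier 2 (e A.carrier 2
      (deRhamCohomology.mk ⟨fubiniStudyPullbackForm A.model ι' A.toComplexPoints, hθ'⟩)))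
    {a : complexBetti (projectiveSpace N ℂ) 2} (ha : IsRationalClass a) (ha0 : a ≠ 0) :
    ∃ s : ℝ, s ≠ 0 ∧ complexBetti.map ι 2 a = (s : ℂ) • H ∧ complexBetti.map ι' 2 a = (s : ℂ) • H' := by
  obtain ⟨s, hs, hs', hs0⟩ := exists_map_eq_smul_of_pullback_eq_fubiniStudy_pair hX A ι ι' e he hθ hθ' hH hH' a
  have hK : A.IsKaehlerClassVia e H := A.isKaehlerClassVia_of_pullback_eq_fubiniStudyPullbackForm e hX ι hθ hH
  have hH0 : H ≠ 0 := hK.ne_zero hX hn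
  have hreal : conjClass (ComplexPoints X) 2 (complexBetti.map ι 2 a) = complexBetti.map ι 2 a :=
    (ha.pullback _).conjClass_eq
  rw [hs, conjClass_smul, hK.conjClass_eq] at hreal
  have hss : (starRingEnd ℂ) s = s := by
    have h := sub_eq_zero.2 hreal
    rw [← sub_smul, smul_eq_zero] at h
    exact sub_eq_zero.1 (h.resolve_right hH0)
  refine ⟨s.re, ?_, ?_, ?_⟩
  · intro h0
    apply hs0 hn ha0
    rw [← Complex.conj_eq_iff_re.1 hss, h0, Complex.ofReal_zero]
  · rw [hs, ← Complex.conj_eq_iff_re.1 hss]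
    rfl
  · rw [hs', ← Complex.conj_eq_iff_re.1 hss]
    rfl

end Pair

end Summit.HodgeConjecture.HodgeConjecture.BiquadraticSecantLift
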